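import Mathlib.Analysis.Calculus.ContDiff.Bounds
import Mathlib.Analysis.Calculus.MeanValue
import Mathlib.Analysis.SpecialFunctions.Pow.Real
import HarnessLib

/-!
# Products of `C^{n,γ}` functions: quantitative Leibniz–Hölder bounds

Analysis/FluidPDE support file (everything proved; no definitions, no named facts), written for
the proof of the named fact `Literature.Analysis.FluidPDE.jia_sverak_2014_local_higher_regularity`
(H. Jia, V. Šverák, Invent. Math. 196 (2014) = arXiv:1204.0529, §3 Thm 3.2 and the bootstrap
remark after its proof, p. 9). In the derivative bootstrap the data of the localised Duhamel
formula at level `n` are products `χ uᵢ u_c` of the level-`n` representative with cut-offs; the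
gain of one derivative (`HeatDuhamelSliceRegularity.lean`) consumes uniform bounds of all
derivatives of the data up to order `n` and the Hölder seminorm of the `n`-th one. This file
provides these bounds for bilinear products, with constants depending only on `n`:

* `holder_of_lipschitz_of_bound` — Lipschitz and bounded is Hölder;
* `hyp_of_succ`, `hyp_fderiv` — `C^{n+1}` data with bounded derivatives are `C^{n,γ}` data, and so
  is their derivative (currying isometries);
* `exists_leibniz_holder` — **for every `n` there is `K(n)` with: for every continuous bilinear
  `B`, `0 < γ ≤ 1`, and `f, g ∈ Cⁿ` with `‖Dᵏf‖, ‖Dᵏg‖ ≤ M` (`k ≤ n`), `[Dⁿf]_γ, [Dⁿg]_γ ≤ M`: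
  `‖Dᵏ(B(f,g))‖ ≤ K‖B‖M²` (`k ≤ n`) and `[Dⁿ(B(f,g))]_γ ≤ K‖B‖M²`** (Mathlib's Leibniz bound
  `ContinuousLinearMap.norm_iteratedFDeriv_le_of_bilinear`, and for the Hölder part an induction
  on `n` through `D(B(f,g)) = B₁(f, Dg) + B₂(Df, g)` with the bilinear maps `B.precompR`,
  `B.precompL`).

## References

* H. Jia, V. Šverák, Invent. Math. 196 (2014) = arXiv:1204.0529, §3 (p. 9). Bib key
  `JiaSverak2014`.
* D. Gilbarg, N. S. Trudinger, *Elliptic Partial Differential Equations of Second Order* (2001),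
  §4.1 (Hölder spaces and products). Bib key `GilbargTrudinger2001`.
-/

noncomputable section

open Set Function Filter Metric
open scoped NNReal ContDiff

namespace Literature.Analysis.FluidPDE

namespace HolderLeibniz

-- nested operator types
set_option maxSynthPendingDepth 3

variable {E : Type} [NormedAddCommGroup E] [NormedSpace ℝ E]

omit [NormedSpace ℝ E] in
/-- **Lipschitz and bounded is Hölder** (operator-free form): `‖f x - f y‖ ≤ max L (2B) ‖x - y‖^γ`
for `0 < γ ≤ 1` if `f` is `L`-Lipschitz and bounded by `B`. [folklore] -/
theorem holder_of_lipschitz_of_bound {F : Type*} [NormedAddCommGroup F] {f : E → F} {L B γ : ℝ}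
    (hL : ∀ x y, ‖f x - f y‖ ≤ L * ‖x - y‖) (hB : ∀ x, ‖f x‖ ≤ B) (hγ0 : 0 < γ) (hγ1 : γ ≤ 1)
    (x y : E) : ‖f x - f y‖ ≤ max L (2 * B) * ‖x - y‖ ^ γ := by
  have hB0 : 0 ≤ B := (norm_nonneg _).trans (hB x)
  set r : ℝ := ‖x - y‖ with hr
  have hr0 : 0 ≤ r := norm_nonneg _
  by_cases hr1 : r ≤ 1
  · have hrr : r ≤ r ^ γ := by
      rcases hr0.eq_or_lt with h | h
      · rw [← h, Real.zero_rpow hγ0.ne']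
      · calc r = r ^ (1 : ℝ) := (Real.rpow_one r).symm
          _ ≤ r ^ γ := Real.rpow_le_rpow_of_exponent_ge h hr1 hγ1
    calc ‖f x - f y‖ ≤ L * r := hL x y
      _ ≤ max L (2 * B) * r ^ γ := by
          rcases le_or_gt 0 L with hL0 | hL0
          · exact (mul_le_mul_of_nonneg_left hrr hL0).trans
              (mul_le_mul_of_nonneg_right (le_max_left _ _) (Real.rpow_nonneg hr0 _))
          · have : L * r ≤ 0 := mul_nonpos_of_nonpos_of_nonneg hL0.le hr0
            exact this.trans (mul_nonneg ((mul_nonneg zero_le_two hB0).trans (le_max_right _ _))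
              (Real.rpow_nonneg hr0 _))
  · push Not at hr1
    have hrγ : 1 ≤ r ^ γ := Real.one_le_rpow hr1.le hγ0.le
    calc ‖f x - f y‖ ≤ ‖f x‖ + ‖f y‖ := norm_sub_le _ _
      _ ≤ 2 * B := by linarith [hB x, hB y]
      _ ≤ max L (2 * B) * r ^ γ := by
          calc 2 * B = 2 * B * 1 := (mul_one _).symm
            _ ≤ max L (2 * B) * r ^ γ :=
                mul_le_mul (le_max_right _ _) hrγ zero_le_one ((mul_nonneg zero_le_two hB0).trans (le_max_right _ _))

/-- The hypotheses of the Leibniz–Hölder bounds: `f ∈ Cⁿ` with `‖Dᵏf‖ ≤ M` (`k ≤ n`) and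
`‖Dⁿf(x) - Dⁿf(y)‖ ≤ M ‖x - y‖^γ`; `C^{n+1}` data with bounded derivatives satisfy them at
level `n` with constant `2M` (mean value inequality). [folklore] -/
theorem hyp_of_succ {F : Type*} [NormedAddCommGroup F] [NormedSpace ℝ F] {n : ℕ} {f : E → F} {M γ : ℝ}
    (hf : ContDiff ℝ (n + 1) f) (hM : ∀ k ≤ n + 1, ∀ x, ‖iteratedFDeriv ℝ k f x‖ ≤ M)
    (hγ0 : 0 < γ) (hγ1 : γ ≤ 1) :
    ContDiff ℝ n f ∧ (∀ k ≤ n, ∀ x, ‖iteratedFDeriv ℝ k f x‖ ≤ 2 * M) ∧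
      ∀ x y, ‖iteratedFDeriv ℝ n f x - iteratedFDeriv ℝ n f y‖ ≤ 2 * M * ‖x - y‖ ^ γ := by
  have hM0 : 0 ≤ M := (norm_nonneg _).trans (hM 0 (Nat.zero_le _) 0)
  refine ⟨hf.of_le (by exact_mod_cast Nat.le_succ n), fun k hk x => (hM k (by omega) x).trans (by linarith), ?_⟩
  -- `Dⁿf` is `M`-Lipschitz (its derivative is `Dⁿ⁺¹f`) and bounded by `M`
  have hd : Differentiable ℝ (iteratedFDeriv ℝ n f) :=
    hf.differentiable_iteratedFDeriv (by exact_mod_cast Nat.lt_succ_self n)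
  have hL : ∀ x y, ‖iteratedFDeriv ℝ n f x - iteratedFDeriv ℝ n f y‖ ≤ M * ‖x - y‖ := fun x y =>
    Convex.norm_image_sub_le_of_norm_fderiv_le (fun z _ => hd z)
      (fun z _ => by rw [norm_fderiv_iteratedFDeriv]; exact hM (n + 1) le_rfl z) convex_univ (mem_univ y) (mem_univ x)
  intro x y
  have h := holder_of_lipschitz_of_bound hL (hM n (Nat.le_succ n)) hγ0 hγ1 x y
  calc _ ≤ max M (2 * M) * ‖x - y‖ ^ γ := h
    _ = 2 * M * ‖x - y‖ ^ γ := by rw [max_eq_right (by linarith)]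

/-- The derivative `Df` of `f ∈ C^{n+1,γ}` is in `C^{n,γ}` with the same constant (the currying
isometry `Dⁿ(Df) ≅ Dⁿ⁺¹f`). [folklore] -/
theorem hyp_fderiv {F : Type*} [NormedAddCommGroup F] [NormedSpace ℝ F] {n : ℕ} {f : E → F} {M γ : ℝ}
    (hf : ContDiff ℝ (n + 1) f) (hM : ∀ k ≤ n + 1, ∀ x, ‖iteratedFDeriv ℝ k f x‖ ≤ M)
    (hH : ∀ x y, ‖iteratedFDeriv ℝ (n + 1) f x - iteratedFDeriv ℝ (n + 1) f y‖ ≤ M * ‖x - y‖ ^ γ) :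
    ContDiff ℝ n (fderiv ℝ f) ∧ (∀ k ≤ n, ∀ x, ‖iteratedFDeriv ℝ k (fderiv ℝ f) x‖ ≤ M) ∧
      ∀ x y, ‖iteratedFDeriv ℝ n (fderiv ℝ f) x - iteratedFDeriv ℝ n (fderiv ℝ f) y‖ ≤ M * ‖x - y‖ ^ γ := by
  refine ⟨hf.fderiv_right (by norm_cast), fun k hk x => ?_, fun x y => ?_⟩
  · rw [norm_iteratedFDeriv_fderiv]; exact hM (k + 1) (by omega) x
  · have e : ∀ z, iteratedFDeriv ℝ (n + 1) f z =
        (continuousMultilinearCurryRightEquiv' ℝ n E F).symm (iteratedFDeriv ℝ n (fderiv ℝ f) z) := fun z =>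
      iteratedFDeriv_succ_eq_comp_right
    have h := hH x y
    rw [e x, e y, ← map_sub, LinearIsometryEquiv.norm_map] at h
    exact h

/-- **Leibniz–Hölder bounds for bilinear products of `C^{n,γ}` functions.** For every `n` there is
`K = K(n)` such that for every continuous bilinear `B : F₁ × F₂ → F₃`, every `0 < γ ≤ 1`, `M ≥ 0`
and all `f ∈ Cⁿ(E; F₁)`, `g ∈ Cⁿ(E; F₂)` with `‖Dᵏf‖, ‖Dᵏg‖ ≤ M` (`k ≤ n`) and
`‖Dⁿf(x) - Dⁿf(y)‖, ‖Dⁿg(x) - Dⁿg(y)‖ ≤ M ‖x - y‖^γ`, the product `h = B(f, g)` satisfies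
`‖Dᵏh‖ ≤ K ‖B‖ M²` (`k ≤ n`) and `‖Dⁿh(x) - Dⁿh(y)‖ ≤ K ‖B‖ M² ‖x - y‖^γ` (the Leibniz bound of
Mathlib, `ContinuousLinearMap.norm_iteratedFDeriv_le_of_bilinear`, and an induction on `n` for
the Hölder part through `D(B(f,g)) = B₁(f, Dg) + B₂(Df, g)`). [folklore] -/
theorem exists_leibniz_holder (n : ℕ) :
    ∃ K : ℝ, 0 ≤ K ∧ ∀ {F₁ F₂ F₃ : Type} [NormedAddCommGroup F₁] [NormedSpace ℝ F₁]
      [NormedAddCommGroup F₂] [NormedSpace ℝ F₂] [NormedAddCommGroup F₃] [NormedSpace ℝ F₃]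
      (B : F₁ →L[ℝ] F₂ →L[ℝ] F₃) {f : E → F₁} {g : E → F₂} {M γ : ℝ}, 0 < γ → γ ≤ 1 → 0 ≤ M →
      ContDiff ℝ n f → ContDiff ℝ n g →
      (∀ k ≤ n, ∀ x, ‖iteratedFDeriv ℝ k f x‖ ≤ M) → (∀ k ≤ n, ∀ x, ‖iteratedFDeriv ℝ k g x‖ ≤ M) →
      (∀ x y, ‖iteratedFDeriv ℝ n f x - iteratedFDeriv ℝ n f y‖ ≤ M * ‖x - y‖ ^ γ) →
      (∀ x y, ‖iteratedFDeriv ℝ n g x - iteratedFDeriv ℝ n g y‖ ≤ M * ‖x - y‖ ^ γ) →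
      (∀ k ≤ n, ∀ x, ‖iteratedFDeriv ℝ k (fun y => B (f y) (g y)) x‖ ≤ K * ‖B‖ * M ^ 2) ∧
      ∀ x y, ‖iteratedFDeriv ℝ n (fun y => B (f y) (g y)) x - iteratedFDeriv ℝ n (fun y => B (f y) (g y)) y‖ ≤
        K * ‖B‖ * M ^ 2 * ‖x - y‖ ^ γ := by
  induction n with
  | zero =>
    refine ⟨2, zero_le_two, ?_⟩
    intro F₁ F₂ F₃ _ _ _ _ _ _ B f g M γ hγ0 hγ1 hM0 hf hg hfb hgb hfH hgH
    have hf0 : ∀ x, ‖f x‖ ≤ M := fun x => by simpa using hfb 0 le_rfl x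
    have hg0 : ∀ x, ‖g x‖ ≤ M := fun x => by simpa using hgb 0 le_rfl x
    have hfH' : ∀ x y, ‖f x - f y‖ ≤ M * ‖x - y‖ ^ γ := fun x y => by
      have h := hfH x y
      rwa [iteratedFDeriv_zero_eq_comp, Function.comp_apply, Function.comp_apply, ← map_sub,
        LinearIsometryEquiv.norm_map] at h
    have hgH' : ∀ x y, ‖g x - g y‖ ≤ M * ‖x - y‖ ^ γ := fun x y => by
      have h := hgH x y
      rwa [iteratedFDeriv_zero_eq_comp, Function.comp_apply, Function.comp_apply, ← map_sub,
        LinearIsometryEquiv.norm_map] at h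
    refine ⟨fun k hk x => ?_, fun x y => ?_⟩
    · have hk0 : k = 0 := Nat.le_zero.1 hk
      subst hk0
      rw [norm_iteratedFDeriv_zero]
      calc ‖B (f x) (g x)‖ ≤ ‖B‖ * ‖f x‖ * ‖g x‖ := B.le_opNorm₂ _ _
        _ ≤ ‖B‖ * M * M := by gcongr <;> first | exact hf0 x | exact hg0 x
        _ ≤ 2 * ‖B‖ * M ^ 2 := by nlinarith [norm_nonneg B, hM0]
    · rw [iteratedFDeriv_zero_eq_comp, Function.comp_apply, Function.comp_apply, ← map_sub,
        LinearIsometryEquiv.norm_map]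
      have e : B (f x) (g x) - B (f y) (g y) = B (f x - f y) (g x) + B (f y) (g x - g y) := by
        simp only [map_sub, _root_.sub_apply]; abel
      rw [e]
      calc ‖B (f x - f y) (g x) + B (f y) (g x - g y)‖
          ≤ ‖B‖ * ‖f x - f y‖ * ‖g x‖ + ‖B‖ * ‖f y‖ * ‖g x - g y‖ :=
            (norm_add_le _ _).trans (add_le_add (B.le_opNorm₂ _ _) (B.le_opNorm₂ _ _))
        _ ≤ ‖B‖ * (M * ‖x - y‖ ^ γ) * M + ‖B‖ * M * (M * ‖x - y‖ ^ γ) := by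
            gcongr <;> first | exact hfH' x y | exact hg0 x | exact hf0 y | exact hgH' x y
        _ = 2 * ‖B‖ * M ^ 2 * ‖x - y‖ ^ γ := by ring
  | succ n ih =>
    obtain ⟨K, hK0, hK⟩ := ih
    refine ⟨max ((2 : ℝ) ^ (n + 1)) (8 * K), le_max_of_le_left (by positivity), ?_⟩
    intro F₁ F₂ F₃ _ _ _ _ _ _ B f g M γ hγ0 hγ1 hM0 hf hg hfb hgb hfH hgH
    set h : E → F₃ := fun y => B (f y) (g y) with hh
    have hhs : ContDiff ℝ (n + 1) h := B.isBoundedBilinearMap.contDiff.comp (hf.prodMk hg)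
    refine ⟨fun k hk x => ?_, fun x y => ?_⟩
    · -- Leibniz bound
      have hL := B.norm_iteratedFDeriv_le_of_bilinear hf hg x (n := k) (by exact_mod_cast hk)
      refine hL.trans ?_
      have hsum : ∑ i ∈ Finset.range (k + 1), (k.choose i : ℝ) * ‖iteratedFDeriv ℝ i f x‖ * ‖iteratedFDeriv ℝ (k - i) g x‖
          ≤ ∑ i ∈ Finset.range (k + 1), (k.choose i : ℝ) * M * M := by
        refine Finset.sum_le_sum fun i hi => ?_
        have hi' : i ≤ k := Nat.lt_succ_iff.1 (Finset.mem_range.1 hi)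
        gcongr
        · exact hfb i (hi'.trans hk) x
        · exact hgb (k - i) ((Nat.sub_le k i).trans hk) x
      have hbin : ∑ i ∈ Finset.range (k + 1), (k.choose i : ℝ) * M * M = (2 : ℝ) ^ k * M ^ 2 := by
        rw [← Finset.sum_mul, ← Finset.sum_mul]
        have : ∑ i ∈ Finset.range (k + 1), (k.choose i : ℝ) = (2 : ℝ) ^ k := by
          have h := Nat.sum_range_choose k
          exact_mod_cast h
        rw [this]; ring
      calc ‖B‖ * ∑ i ∈ Finset.range (k + 1), (k.choose i : ℝ) * ‖iteratedFDeriv ℝ i f x‖ * ‖iteratedFDeriv ℝ (k - i) g x‖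
          ≤ ‖B‖ * ((2 : ℝ) ^ k * M ^ 2) := by rw [← hbin]; exact mul_le_mul_of_nonneg_left hsum (norm_nonneg _)
        _ ≤ ‖B‖ * ((2 : ℝ) ^ (n + 1) * M ^ 2) := by
            gcongr
            · norm_num
        _ ≤ max ((2 : ℝ) ^ (n + 1)) (8 * K) * ‖B‖ * M ^ 2 := by
            have h1 : (2 : ℝ) ^ (n + 1) ≤ max ((2 : ℝ) ^ (n + 1)) (8 * K) := le_max_left _ _
            have h0 : 0 ≤ ‖B‖ * M ^ 2 := by positivity
            calc ‖B‖ * ((2 : ℝ) ^ (n + 1) * M ^ 2) = (2 : ℝ) ^ (n + 1) * (‖B‖ * M ^ 2) := by ring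
              _ ≤ max ((2 : ℝ) ^ (n + 1)) (8 * K) * (‖B‖ * M ^ 2) := mul_le_mul_of_nonneg_right h1 h0
              _ = _ := by ring
    · -- Hölder bound for `Dⁿ⁺¹h` through `Dh = B₁(f, Dg) + B₂(Df, g)`
      obtain ⟨hf', hfb', hfH'⟩ := hyp_of_succ hf hfb hγ0 hγ1
      obtain ⟨hg', hgb', hgH'⟩ := hyp_of_succ hg hgb hγ0 hγ1
      obtain ⟨hDf, hDfb, hDfH⟩ := hyp_fderiv hf hfb hfH
      obtain ⟨hDg, hDgb, hDgH⟩ := hyp_fderiv hg hgb hgH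
      -- weaken the constants of `Df`, `Dg` to `2M`
      have hM2 : 0 ≤ 2 * M := by linarith
      have hDfb2 : ∀ k ≤ n, ∀ x, ‖iteratedFDeriv ℝ k (fderiv ℝ f) x‖ ≤ 2 * M := fun k hk x => (hDfb k hk x).trans (by linarith)
      have hDgb2 : ∀ k ≤ n, ∀ x, ‖iteratedFDeriv ℝ k (fderiv ℝ g) x‖ ≤ 2 * M := fun k hk x => (hDgb k hk x).trans (by linarith)
      have hDfH2 : ∀ x y, ‖iteratedFDeriv ℝ n (fderiv ℝ f) x - iteratedFDeriv ℝ n (fderiv ℝ f) y‖ ≤ 2 * M * ‖x - y‖ ^ γ :=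
        fun x y => (hDfH x y).trans (mul_le_mul_of_nonneg_right (by linarith) (Real.rpow_nonneg (norm_nonneg _) _))
      have hDgH2 : ∀ x y, ‖iteratedFDeriv ℝ n (fderiv ℝ g) x - iteratedFDeriv ℝ n (fderiv ℝ g) y‖ ≤ 2 * M * ‖x - y‖ ^ γ :=
        fun x y => (hDgH x y).trans (mul_le_mul_of_nonneg_right (by linarith) (Real.rpow_nonneg (norm_nonneg _) _))
      set B₁ : F₁ →L[ℝ] (E →L[ℝ] F₂) →L[ℝ] (E →L[ℝ] F₃) := B.precompR E with hB₁
      set B₂ : (E →L[ℝ] F₁) →L[ℝ] F₂ →L[ℝ] (E →L[ℝ] F₃) := B.precompL E with hB₂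
      have hB₁n : ‖B₁‖ ≤ ‖B‖ := ContinuousLinearMap.norm_precompR_le (Eₗ := E) B
      have hB₂n : ‖B₂‖ ≤ ‖B‖ := ContinuousLinearMap.norm_precompL_le (Eₗ := E) B
      have hDh : fderiv ℝ h = fun y => B₁ (f y) (fderiv ℝ g y) + B₂ (fderiv ℝ f y) (g y) := by
        funext y
        exact B.fderiv_of_bilinear ((hf.differentiable (by simp)) y) ((hg.differentiable (by simp)) y)
      -- the two pieces
      have h1 := (hK B₁ hγ0 hγ1 hM2 hf' hDg hfb' hDgb2 hfH' hDgH2).2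
      have h2 := (hK B₂ hγ0 hγ1 hM2 hDf hg' hDfb2 hgb' hDfH2 hgH').2
      have hc1 : ContDiff ℝ n fun y => B₁ (f y) (fderiv ℝ g y) := B₁.isBoundedBilinearMap.contDiff.comp (hf'.prodMk hDg)
      have hc2 : ContDiff ℝ n fun y => B₂ (fderiv ℝ f y) (g y) := B₂.isBoundedBilinearMap.contDiff.comp (hDf.prodMk hg')
      have e : ∀ z, iteratedFDeriv ℝ (n + 1) h z =
          (continuousMultilinearCurryRightEquiv' ℝ n E F₃).symm (iteratedFDeriv ℝ n (fderiv ℝ h) z) := fun z =>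
        iteratedFDeriv_succ_eq_comp_right
      have hadd : ∀ z, iteratedFDeriv ℝ n (fderiv ℝ h) z =
          iteratedFDeriv ℝ n (fun y => B₁ (f y) (fderiv ℝ g y)) z + iteratedFDeriv ℝ n (fun y => B₂ (fderiv ℝ f y) (g y)) z := by
        intro z
        rw [hDh]
        exact iteratedFDeriv_add_apply (hc1.contDiffAt) (hc2.contDiffAt)
      rw [e x, e y, ← map_sub, LinearIsometryEquiv.norm_map, hadd x, hadd y]
      have hKB : K * ‖B₁‖ * (2 * M) ^ 2 ≤ 4 * K * ‖B‖ * M ^ 2 := by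
        have h0 : 0 ≤ K * M ^ 2 := by positivity
        calc K * ‖B₁‖ * (2 * M) ^ 2 = 4 * ‖B₁‖ * (K * M ^ 2) := by ring
          _ ≤ 4 * ‖B‖ * (K * M ^ 2) := by gcongr
          _ = 4 * K * ‖B‖ * M ^ 2 := by ring
      have hKB' : K * ‖B₂‖ * (2 * M) ^ 2 ≤ 4 * K * ‖B‖ * M ^ 2 := by
        have h0 : 0 ≤ K * M ^ 2 := by positivity
        calc K * ‖B₂‖ * (2 * M) ^ 2 = 4 * ‖B₂‖ * (K * M ^ 2) := by ring
          _ ≤ 4 * ‖B‖ * (K * M ^ 2) := by gcongr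
          _ = 4 * K * ‖B‖ * M ^ 2 := by ring
      have hr : 0 ≤ ‖x - y‖ ^ γ := Real.rpow_nonneg (norm_nonneg _) _
      calc ‖iteratedFDeriv ℝ n (fun y => B₁ (f y) (fderiv ℝ g y)) x + iteratedFDeriv ℝ n (fun y => B₂ (fderiv ℝ f y) (g y)) x -
            (iteratedFDeriv ℝ n (fun y => B₁ (f y) (fderiv ℝ g y)) y + iteratedFDeriv ℝ n (fun y => B₂ (fderiv ℝ f y) (g y)) y)‖
          = ‖(iteratedFDeriv ℝ n (fun y => B₁ (f y) (fderiv ℝ g y)) x - iteratedFDeriv ℝ n (fun y => B₁ (f y) (fderiv ℝ g y)) y) +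
              (iteratedFDeriv ℝ n (fun y => B₂ (fderiv ℝ f y) (g y)) x - iteratedFDeriv ℝ n (fun y => B₂ (fderiv ℝ f y) (g y)) y)‖ := by
            congr 1; abel
        _ ≤ K * ‖B₁‖ * (2 * M) ^ 2 * ‖x - y‖ ^ γ + K * ‖B₂‖ * (2 * M) ^ 2 * ‖x - y‖ ^ γ :=
            (norm_add_le _ _).trans (add_le_add (h1 x y) (h2 x y))
        _ ≤ 4 * K * ‖B‖ * M ^ 2 * ‖x - y‖ ^ γ + 4 * K * ‖B‖ * M ^ 2 * ‖x - y‖ ^ γ :=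
            add_le_add (mul_le_mul_of_nonneg_right hKB hr) (mul_le_mul_of_nonneg_right hKB' hr)
        _ = 8 * K * ‖B‖ * M ^ 2 * ‖x - y‖ ^ γ := by ring
        _ ≤ max ((2 : ℝ) ^ (n + 1)) (8 * K) * ‖B‖ * M ^ 2 * ‖x - y‖ ^ γ := by
            have h8 : 8 * K ≤ max ((2 : ℝ) ^ (n + 1)) (8 * K) := le_max_right _ _
            have h0 : 0 ≤ ‖B‖ * M ^ 2 * ‖x - y‖ ^ γ := by positivity
            calc 8 * K * ‖B‖ * M ^ 2 * ‖x - y‖ ^ γ = 8 * K * (‖B‖ * M ^ 2 * ‖x - y‖ ^ γ) := by ring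
              _ ≤ max ((2 : ℝ) ^ (n + 1)) (8 * K) * (‖B‖ * M ^ 2 * ‖x - y‖ ^ γ) :=
                  mul_le_mul_of_nonneg_right h8 h0
              _ = _ := by ring

end HolderLeibniz

end Literature.Analysis.FluidPDE
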